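import Summits.PneNP.PneNP.Theorems.ChebyshevTracialDesignCrossingPinTracial
import HarnessLib

/-!
# Cell pnp-psdrank, route `ChebyshevTracialDesign`: VIRTUAL NONNEGATIVITY HOLDS ON THE CROSSING-PINNED CLASS — the virtual value of a
# crossing-pinned rectangle / psd strategy is `O(B·√(P_{D−4}μν))` resp. `O(B·r·√P_{D−4})` in absolute value

Harmonic backbone of the crux `TracialDecayExp20` (stmt-PneNP-19878), brick 24c (prover g7). The crux is kernel-equivalent to virtual
nonnegativity of entrywise-truncated tight psd strategies (`…VirtualReduction.tracialDecayExp20_iff_virtualNonneg`). Combining the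
truncation theorems (bricks 19, 22a: design value `= −(virtual value) ± tail`) with the crossing-pin lemmas (bricks 23b, 24b: design value
`= 0 ± tail`) gives the virtual value itself on the crossing-pinned class, with NO sign ambiguity:
* `crossingPin_virtual_abs_le` (0/1 rectangles): for `X` crossed by `{a,b}` and `Y ∋ {a,b}`,
  `|(1/|PM|)·Σ_{M∈Y} Ẽ_M[(1_X)_{≤D}]| ≤ B·(√(P_D μν) + √(P_{D−4} μν))`;
* `crossingPin_tracial_virtual_abs_le` (contractions of any dimension `r`): for `X_U = 0` unless `{a,b}` crosses `U`, `Y_M = 0` unless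
  `{a,b} ∈ M`, `0 ⪯ X_U, Y_M ⪯ I_r`, and EVERY harmonic datum `p` of the entries of `X`,
  `|(1/|PM|)·Σ_M Σ_{|A|≤D} tr(Q_A(p) Y_M)·knapsackMoment(|M|, t/2, |M[A]|)| ≤ B·r·(√P_D + √P_{D−4})`.
So the hypothesis `VIRT(a)` of the crux reduction is PROVED on the crossing-pinned class (with room to spare: `B r(√P_D+√P_{D−4}) = r·e^{−Ω(D log n)}`
against the required `−(e^{−aD}/2)·r`); what remains open is exactly the complementary class — strategies with no common crossing pin
(after the route's conditioning), i.e. the spread-vs-tight statement. [cite: Rothvoss2017, §2 and Lemma 7 (PDF pp. 6–8)]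
[cite: Grigoriev2001, §1 and Lemma 1.4 (PDF p. 8)] [cite: GriblingDelaatLaurent2019, §5]
Stature: support/instrument. WHAT THIS IS NOT: not VIRT for general strategies, nothing on psd rank by itself, no P-vs-NP content.
Supports stmt-PneNP-19878.
-/

set_option linter.dupNamespace false -- `Summit.PneNP.PneNP.…`: summit = sub-problem (D-0017)

noncomputable section

namespace Summit.PneNP.PneNP.Theorems.ChebyshevTracialDesignCrossingPinVirtual

open Finset Matrix Literature.Barriers.PneNP Literature.Combinatorics.Optimization Literature.Computability.Complexity
open Literature.Combinatorics.SimpleGraph.CycleSpace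
open Literature.Combinatorics.AssociationSchemes Literature.Combinatorics.AssociationSchemes.JohnsonHarmonics
open Summit.PneNP.PneNP.Theorems.ChebyshevTracialDesignLevelTail
open Summit.PneNP.PneNP.Theorems.ChebyshevTracialDesignProfilePolynomial
open Summit.PneNP.PneNP.Theorems.ChebyshevTracialDesignProfileExtrapolation
open Summit.PneNP.PneNP.Theorems.ChebyshevTracialDesignTracialProfilePolynomial
open Summit.PneNP.PneNP.Theorems.ChebyshevTracialDesignVirtualValueUnique
open Summit.PneNP.PneNP.Theorems.ChebyshevTracialDesignCrossingPin
open Summit.PneNP.PneNP.Theorems.ChebyshevTracialDesignCrossingPinTracial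

variable {n : ℕ}

/-- **The virtual value of a crossing-pinned rectangle is negligible.** For `n` even, an exact design `(n, t = 2c'+1, T, D, B, C, w)` with
`4 ≤ D < t`, an edge `{a,b}`, a family `X` of `t`-subsets each crossed by `{a,b}` with harmonic layer decomposition `p` of its indicator,
and a set `Y` of perfect matchings each containing `{a,b}`:
`|(1/|PM|)·Σ_{M∈Y} Σ_{|A|≤D} q_A·knapsackMoment(|M|, t/2, |M[A]|)| ≤ B·(√(P_D·μν) + √(P_{D−4}·μν))`, `q` the low-part coefficient vector of `1_X`.
[cite: Rothvoss2017, §2 and Lemma 7 (PDF pp. 6–8)] [cite: Grigoriev2001, Lemma 1.4 (PDF p. 8)] -/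
theorem crossingPin_virtual_abs_le {c' T D : ℕ} {Bv : ℝ} {C : Finset ℕ} {w : ℕ → ℝ} (hn : Even n)
    (hdes : IsExactDesign n (2 * c' + 1) T D Bv C w) (hD : D ≤ 2 * c') (hD4 : 4 ≤ D) (a b : Fin n)
    (X : Finset (Finset (Fin n))) (hX : X ⊆ univ.powersetCard (2 * c' + 1)) (hXcross : ∀ U ∈ X, Crosses U s(a, b))
    (Y : Finset (PMatch n)) (hY : ∀ M ∈ Y, s(a, b) ∈ M.1)
    (p : ℕ → Finset (Fin n) → ℝ) (hp : ∀ j, IsHarmonic j (p j))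
    (hdec : ∀ U ∈ univ.powersetCard (2 * c' + 1),
      (if U ∈ X then (1 : ℝ) else 0) = (∑ j ∈ range (2 * c' + 1 + 1), up^[2 * c' + 1 - j] (p j)) U) :
    |(Fintype.card (PMatch n) : ℝ)⁻¹ * ∑ M ∈ Y,
        ∑ A : {A : Finset (Fin n) // A.card ≤ D},
          (∑ j ∈ range (2 * c' + 1 + 1), ((2 * c' + 1 - j).factorial : ℝ) • (if D < j then 0 else p j)) A.1 *
            knapsackMoment M.1.card (((2 * c' + 1 : ℕ) : ℝ) / 2) (M.1.filter fun e => ∃ a ∈ A.1, a ∈ e).card| ≤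
      Bv * (Real.sqrt ((∏ i ∈ range (D / 2 + 1), ((2 * i + 1 : ℝ) / ((n : ℝ) - 2 * i))) *
          ((X.card : ℝ) / (n.choose (2 * c' + 1) : ℝ)) * ((Y.card : ℝ) / (Fintype.card (PMatch n) : ℝ))) +
        Real.sqrt ((∏ i ∈ range ((D - 4) / 2 + 1), ((2 * i + 1 : ℝ) / ((n : ℝ) - 2 * i))) *
          ((X.card : ℝ) / (n.choose (2 * c' + 1) : ℝ)) * ((Y.card : ℝ) / (Fintype.card (PMatch n) : ℝ)))) := by
  have h1 := rectangle_value_truncation_explicit hn hdes hD X hX Y p hp hdec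
  have h2 := crossingPin_value_le hn hdes hD hD4 a b X hX hXcross Y hY
  rw [abs_le] at h1 h2 ⊢
  constructor <;> nlinarith [h1.1, h1.2, h2.1, h2.2]

/-- **The virtual value of a crossing-pinned pair of contraction families is negligible, at every dimension.** For `n` even, an exact
design `(n, t = 2c'+1, T, D, B, C, w)` with `4 ≤ D < t`, an edge `{a,b}`, `X : OddSet n → M_r(ℝ)` vanishing off the cuts crossed by
`{a,b}`, `Y : PM_n → M_r(ℝ)` vanishing off the matchings containing `{a,b}`, both families of contractions (`0 ⪯ · ⪯ I_r`), and EVERY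
harmonic datum `p` of the entries of `X`: the averaged Grigoriev pseudo-expectation of the entrywise truncation satisfies
`|(1/|PM|)·Σ_M Σ_{|A|≤D} tr(Q_A Y_M)·knapsackMoment(|M|, t/2, |M[A]|)| ≤ B·r·(√P_D + √P_{D−4})` — virtual nonnegativity (indeed virtual
NEGLIGIBILITY) holds on the crossing-pinned class. [cite: Rothvoss2017, §2 and Lemma 7 (PDF pp. 6–8)] [cite: Grigoriev2001, Lemma 1.4 (PDF p. 8)]
[cite: GriblingDelaatLaurent2019, §5] -/
theorem crossingPin_tracial_virtual_abs_le {c' T D r : ℕ} {Bv : ℝ} {C : Finset ℕ} {w : ℕ → ℝ} (hn : Even n)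
    (hdes : IsExactDesign n (2 * c' + 1) T D Bv C w) (hD : D ≤ 2 * c') (hD4 : 4 ≤ D) (a b : Fin n)
    (X : OddSet n → Matrix (Fin r) (Fin r) ℝ) (Y : PMatch n → Matrix (Fin r) (Fin r) ℝ)
    (hX : ∀ U : OddSet n, ¬ Crosses U.1 s(a, b) → X U = 0) (hY : ∀ M : PMatch n, s(a, b) ∉ M.1 → Y M = 0)
    (hXc : ∀ U, (X U).PosSemidef ∧ (1 - X U).PosSemidef) (hYc : ∀ M, (Y M).PosSemidef ∧ (1 - Y M).PosSemidef)
    (p : Fin r × Fin r → ℕ → Finset (Fin n) → ℝ) (hp : ∀ ab j, IsHarmonic j (p ab j))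
    (hdec : ∀ ab (U : OddSet n), U.1.card = 2 * c' + 1 →
      X U ab.1 ab.2 = (∑ j ∈ range (2 * c' + 1 + 1), up^[2 * c' + 1 - j] (p ab j)) U.1) :
    |(Fintype.card (PMatch n) : ℝ)⁻¹ * ∑ M : PMatch n, ∑ A : {A : Finset (Fin n) // A.card ≤ D},
        (Matrix.of (fun a' b' : Fin r =>
          (∑ j ∈ range (2 * c' + 1 + 1), ((2 * c' + 1 - j).factorial : ℝ) • (if D < j then 0 else p (a', b') j)) A.1) *
            Y M).trace *
          knapsackMoment M.1.card (((2 * c' + 1 : ℕ) : ℝ) / 2) (M.1.filter fun e => ∃ v ∈ A.1, v ∈ e).card| ≤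
      Bv * ((r : ℝ) * (Real.sqrt (∏ i ∈ range (D / 2 + 1), ((2 * i + 1 : ℝ) / ((n : ℝ) - 2 * i))) +
        Real.sqrt (∏ i ∈ range ((D - 4) / 2 + 1), ((2 * i + 1 : ℝ) / ((n : ℝ) - 2 * i))))) := by
  have ht : 2 * (2 * c' + 1) + 2 ≤ n := hdes.2.1
  have hB := hdes.2.2.2.2.2.2
  have hPm : (0 : ℝ) < Fintype.card (PMatch n) := by exact_mod_cast card_pmatch_pos hn
  have hCn : (0 : ℝ) < n.choose (2 * c' + 1) := by exact_mod_cast Nat.choose_pos (by omega)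
  have hPD := prod_atten_nonneg (n := n) (K := D) (by omega)
  have hw0 : 0 ≤ ∑ c ∈ C, |w c| := sum_nonneg fun c _ => abs_nonneg _
  -- truncation for the given datum (brick 22a) with the contraction tail, and the tracial crossing-pin lemma (brick 24b)
  have h1 := tracial_value_truncation_of_data hn hdes hD X Y p hp hdec
  have htail := sqrt_tail_le_of_le hPD hCn hPm (Nat.cast_nonneg r)
    (sum_nonneg fun M _ => by positivity) (sum_frobenius_cuts_le ⟨c', rfl⟩ hXc) (sum_frobenius_matchings_le hYc)
  have h1' := h1.trans (mul_le_mul hB htail (Real.sqrt_nonneg _) (hw0.trans hB))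
  have h2 := crossingPin_tracial_value_le_of_contractions hn hdes hD hD4 a b X Y hX hY hXc hYc
  rw [abs_le] at h1' h2 ⊢
  constructor <;> nlinarith [h1'.1, h1'.2, h2.1, h2.2]

end Summit.PneNP.PneNP.Theorems.ChebyshevTracialDesignCrossingPinVirtual
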